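import Literature.Analysis.FunctionSpaces.TorusDerivSizeBounds
import Literature.MathematicalPhysics.KineticTheory.HardSphereEuler

/-!
# Products minus their top-order part: pointwise Leibniz remainder bounds of orders 1, 2, 3 on `𝕋³`

Helper file for the line `log-lipschitz-budget` of the crux `ImplosionDichotomy.PolynomialCompression`
(stmt-AtomisticToContinuum-12587), stub `stub_logBudgetShadowing` (level-3 estimate). In the commutator
terms of the thrice-differentiated difference system every summand is a product `f · g` of a
COEFFICIENT `f` (a derivative of the σ-solution) and a derivative `g` of the difference `δV`; the term
with all derivatives on `g` is the top-order part (estimated by the Type-I audit), the rest is of lower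
order in `g`. From the identities `Torus.partialDeriv_mul_sub`, `partialDeriv₂_mul_sub`,
`partialDeriv₃_mul_sub` (`TorusLowOrderLeibniz`).
-/

noncomputable section

namespace Summit.AtomisticToContinuum.HydrodynamicLimit.Theorems

open Set
open Literature.MathematicalPhysics.KineticTheory Literature.Analysis.FunctionSpaces

/-! ## Private helpers: linearity of `Torus.partialDeriv` as identities of functions -/

/-- Finite sums of smooth functions are smooth (applied-sum form). [folklore] -/
private theorem isSmooth_fun_sum {ι : Type} (s : Finset ι) {F : ι → T3 → ℝ}
    (hF : ∀ m ∈ s, Torus.IsSmooth (F m)) : Torus.IsSmooth (fun y => ∑ m ∈ s, F m y) := by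
  have hl : Torus.lift (fun y => ∑ m ∈ s, F m y) = fun z => ∑ m ∈ s, Torus.lift (F m) z := rfl
  unfold Torus.IsSmooth
  rw [hl]
  exact ContDiff.sum fun m hm => hF m hm

/-- Partial derivatives of finite sums of smooth functions, as functions. [folklore] -/
private theorem partialDeriv_fun_sum {ι : Type} (s : Finset ι) {F : ι → T3 → ℝ}
    (hF : ∀ m ∈ s, Torus.IsSmooth (F m)) (i : Fin 3) :
    Torus.partialDeriv i (fun y => ∑ m ∈ s, F m y) = fun y => ∑ m ∈ s, Torus.partialDeriv i (F m) y := by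
  classical
  induction s using Finset.induction_on with
  | empty =>
    funext x
    simp [Torus.partialDeriv, Torus.lineDeriv]
  | insert a s ha ih =>
    have hFa : Torus.IsSmooth (F a) := hF a (Finset.mem_insert_self a s)
    have hFs : ∀ m ∈ s, Torus.IsSmooth (F m) := fun m hm => hF m (Finset.mem_insert_of_mem hm)
    have e : (fun y => ∑ m ∈ insert a s, F m y) = F a + fun y => ∑ m ∈ s, F m y := by
      funext y; rw [Finset.sum_insert ha]; rfl
    rw [e, Torus.partialDeriv_add (hFa.isContDiff (by simp)) ((isSmooth_fun_sum s hFs).isContDiff (by simp)),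
      ih hFs]
    funext y; rw [Finset.sum_insert ha]; rfl

/-- Partial derivatives of differences of smooth functions, as functions. [folklore] -/
private theorem partialDeriv_fun_sub {F G : T3 → ℝ} (hF : Torus.IsSmooth F) (hG : Torus.IsSmooth G)
    (i : Fin 3) :
    Torus.partialDeriv i (fun y => F y - G y) = fun y => Torus.partialDeriv i F y - Torus.partialDeriv i G y := by
  have e : (fun y => F y - G y) = F + (-1 : ℝ) • G := by
    funext y; simp [sub_eq_add_neg]
  rw [e, Torus.partialDeriv_add (hF.isContDiff (by simp)) ((Torus.IsSmooth.smul (-1) hG).isContDiff (by simp)),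
    Torus.partialDeriv_const_smul (hG.isContDiff (by simp))]
  funext y; simp [sub_eq_add_neg]


/-- **Leibniz remainders after removing the top-order part.** For smooth real `f, g` on `𝕋³` with
`|f| ≤ f₀`, `|∂f| ≤ f₁`, `|∂²f| ≤ f₂`, `|∂³f| ≤ f₃` and `|g| ≤ g₀`, `|∂g| ≤ g₁`, `|∂²g| ≤ g₂` at `x`:
`|∂ᵢ(fg) - f ∂ᵢg| ≤ f₁g₀`, `|∂ⱼ∂ᵢ(fg) - f ∂ⱼ∂ᵢg| ≤ 2f₁g₁ + f₂g₀`,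
`|∂ₖ∂ⱼ∂ᵢ(fg) - f ∂ₖ∂ⱼ∂ᵢg| ≤ 3f₁g₂ + 3f₂g₁ + f₃g₀` (all derivatives `Torus.partialDeriv`, nesting
`∂ₖ(∂ⱼ(∂ᵢ ·))`). [folklore] -/
theorem abs_partialDeriv_mul_sub_top_le :
    ∀ {f g : T3 → ℝ} {x : T3} {f₀ f₁ f₂ f₃ g₀ g₁ g₂ : ℝ},
      Torus.IsSmooth f → Torus.IsSmooth g →
      |f x| ≤ f₀ → (∀ i, |Torus.partialDeriv i f x| ≤ f₁) →
      (∀ i j, |Torus.partialDeriv j (Torus.partialDeriv i f) x| ≤ f₂) →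
      (∀ i j k, |Torus.partialDeriv k (Torus.partialDeriv j (Torus.partialDeriv i f)) x| ≤ f₃) →
      |g x| ≤ g₀ → (∀ i, |Torus.partialDeriv i g x| ≤ g₁) →
      (∀ i j, |Torus.partialDeriv j (Torus.partialDeriv i g) x| ≤ g₂) →
      (∀ i, |Torus.partialDeriv i (fun y => f y * g y) x - f x * Torus.partialDeriv i g x| ≤ f₁ * g₀) ∧
      (∀ i j, |Torus.partialDeriv j (Torus.partialDeriv i (fun y => f y * g y)) x -
          f x * Torus.partialDeriv j (Torus.partialDeriv i g) x| ≤ 2 * (f₁ * g₁) + f₂ * g₀) ∧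
      (∀ i j k, |Torus.partialDeriv k (Torus.partialDeriv j (Torus.partialDeriv i (fun y => f y * g y))) x -
          f x * Torus.partialDeriv k (Torus.partialDeriv j (Torus.partialDeriv i g)) x| ≤
        3 * (f₁ * g₂) + 3 * (f₂ * g₁) + f₃ * g₀) := by
  intro f g x f₀ f₁ f₂ f₃ g₀ g₁ g₂ hf hg _ hf₁ hf₂ hf₃ hg₀ hg₁ hg₂
  refine ⟨fun i => ?_, fun i j => ?_, fun i j k => ?_⟩
  · rw [Torus.partialDeriv_mul_sub hf hg i x, abs_mul]
    exact mul_le_mul (hf₁ i) hg₀ (abs_nonneg _) ((abs_nonneg _).trans (hf₁ i))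
  · rw [Torus.partialDeriv₂_mul_sub hf hg i j x]
    have n1 : 0 ≤ f₁ := (abs_nonneg _).trans (hf₁ i)
    have n2 : 0 ≤ f₂ := (abs_nonneg _).trans (hf₂ i j)
    have h2 : |Torus.partialDeriv j (Torus.partialDeriv i f) x * g x| ≤ f₂ * g₀ := by
      rw [abs_mul]; exact mul_le_mul (hf₂ i j) hg₀ (abs_nonneg _) n2
    have h3 : |Torus.partialDeriv i f x * Torus.partialDeriv j g x| ≤ f₁ * g₁ := by
      rw [abs_mul]; exact mul_le_mul (hf₁ i) (hg₁ j) (abs_nonneg _) n1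
    have h4 : |Torus.partialDeriv j f x * Torus.partialDeriv i g x| ≤ f₁ * g₁ := by
      rw [abs_mul]; exact mul_le_mul (hf₁ j) (hg₁ i) (abs_nonneg _) n1
    have h5 := abs_add_three (Torus.partialDeriv j (Torus.partialDeriv i f) x * g x)
      (Torus.partialDeriv i f x * Torus.partialDeriv j g x) (Torus.partialDeriv j f x * Torus.partialDeriv i g x)
    linarith
  · rw [Torus.partialDeriv₃_mul_sub hf hg i j k x]
    have n1 : 0 ≤ f₁ := (abs_nonneg _).trans (hf₁ i)
    have n2 : 0 ≤ f₂ := (abs_nonneg _).trans (hf₂ i j)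
    have n3 : 0 ≤ f₃ := (abs_nonneg _).trans (hf₃ i j k)
    set B₁ := Torus.partialDeriv k (Torus.partialDeriv j (Torus.partialDeriv i f)) x * g x
    set B₂ := Torus.partialDeriv j (Torus.partialDeriv i f) x * Torus.partialDeriv k g x
    set B₃ := Torus.partialDeriv k (Torus.partialDeriv i f) x * Torus.partialDeriv j g x
    set B₄ := Torus.partialDeriv i f x * Torus.partialDeriv k (Torus.partialDeriv j g) x
    set B₅ := Torus.partialDeriv k (Torus.partialDeriv j f) x * Torus.partialDeriv i g x
    set B₆ := Torus.partialDeriv j f x * Torus.partialDeriv k (Torus.partialDeriv i g) x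
    set B₇ := Torus.partialDeriv k f x * Torus.partialDeriv j (Torus.partialDeriv i g) x
    have h1 : |B₁| ≤ f₃ * g₀ := by
      simp only [B₁]; rw [abs_mul]; exact mul_le_mul (hf₃ i j k) hg₀ (abs_nonneg _) n3
    have h2 : |B₂| ≤ f₂ * g₁ := by
      simp only [B₂]; rw [abs_mul]; exact mul_le_mul (hf₂ i j) (hg₁ k) (abs_nonneg _) n2
    have h3 : |B₃| ≤ f₂ * g₁ := by
      simp only [B₃]; rw [abs_mul]; exact mul_le_mul (hf₂ i k) (hg₁ j) (abs_nonneg _) n2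
    have h4 : |B₄| ≤ f₁ * g₂ := by
      simp only [B₄]; rw [abs_mul]; exact mul_le_mul (hf₁ i) (hg₂ j k) (abs_nonneg _) n1
    have h5 : |B₅| ≤ f₂ * g₁ := by
      simp only [B₅]; rw [abs_mul]; exact mul_le_mul (hf₂ j k) (hg₁ i) (abs_nonneg _) n2
    have h6 : |B₆| ≤ f₁ * g₂ := by
      simp only [B₆]; rw [abs_mul]; exact mul_le_mul (hf₁ j) (hg₂ i k) (abs_nonneg _) n1
    have h7 : |B₇| ≤ f₁ * g₂ := by
      simp only [B₇]; rw [abs_mul]; exact mul_le_mul (hf₁ k) (hg₂ i j) (abs_nonneg _) n1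
    have t2 := abs_add_le (B₁ + B₂ + B₃ + B₄ + B₅ + B₆) B₇
    have t3 := abs_add_le (B₁ + B₂ + B₃ + B₄ + B₅) B₆
    have t4 := abs_add_le (B₁ + B₂ + B₃ + B₄) B₅
    have t5 := abs_add_le (B₁ + B₂ + B₃) B₄
    have t6 := abs_add_three B₁ B₂ B₃
    linarith

/-- **The same with the top-order part on the FIRST factor** (`g` the coefficient): with
`|g|, |∂g|, |∂²g|, |∂³g| ≤ g₀, g₁, g₂, g₃` and `|f| ≤ f₀`, `|∂f| ≤ f₁`, `|∂²f| ≤ f₂` at `x`: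
`|∂ᵢ(fg) - (∂ᵢf) g| ≤ f₀g₁`, `|∂ⱼ∂ᵢ(fg) - (∂ⱼ∂ᵢf) g| ≤ 2f₁g₁ + f₀g₂`,
`|∂ₖ∂ⱼ∂ᵢ(fg) - (∂ₖ∂ⱼ∂ᵢf) g| ≤ 3f₂g₁ + 3f₁g₂ + f₀g₃`. [folklore] -/
theorem abs_partialDeriv_mul_sub_top_le' :
    ∀ {f g : T3 → ℝ} {x : T3} {f₀ f₁ f₂ g₀ g₁ g₂ g₃ : ℝ},
      Torus.IsSmooth f → Torus.IsSmooth g →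
      |f x| ≤ f₀ → (∀ i, |Torus.partialDeriv i f x| ≤ f₁) →
      (∀ i j, |Torus.partialDeriv j (Torus.partialDeriv i f) x| ≤ f₂) →
      |g x| ≤ g₀ → (∀ i, |Torus.partialDeriv i g x| ≤ g₁) →
      (∀ i j, |Torus.partialDeriv j (Torus.partialDeriv i g) x| ≤ g₂) →
      (∀ i j k, |Torus.partialDeriv k (Torus.partialDeriv j (Torus.partialDeriv i g)) x| ≤ g₃) →
      (∀ i, |Torus.partialDeriv i (fun y => f y * g y) x - Torus.partialDeriv i f x * g x| ≤ f₀ * g₁) ∧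
      (∀ i j, |Torus.partialDeriv j (Torus.partialDeriv i (fun y => f y * g y)) x -
          Torus.partialDeriv j (Torus.partialDeriv i f) x * g x| ≤ 2 * (f₁ * g₁) + f₀ * g₂) ∧
      (∀ i j k, |Torus.partialDeriv k (Torus.partialDeriv j (Torus.partialDeriv i (fun y => f y * g y))) x -
          Torus.partialDeriv k (Torus.partialDeriv j (Torus.partialDeriv i f)) x * g x| ≤
        3 * (f₂ * g₁) + 3 * (f₁ * g₂) + f₀ * g₃) := by
  intro f g x f₀ f₁ f₂ g₀ g₁ g₂ g₃ hf hg hf₀ hf₁ hf₂ hg₀ hg₁ hg₂ hg₃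
  have e : (fun y => f y * g y) = fun y => g y * f y := funext fun y => mul_comm _ _
  obtain ⟨h1, h2, h3⟩ :=
    abs_partialDeriv_mul_sub_top_le (f := g) (g := f) (x := x) hg hf hg₀ hg₁ hg₂ hg₃ hf₀ hf₁ hf₂
  refine ⟨fun i => ?_, fun i j => ?_, fun i j k => ?_⟩
  · rw [e, mul_comm (Torus.partialDeriv i f x) (g x), mul_comm f₀ g₁]
    exact h1 i
  · rw [e, mul_comm (Torus.partialDeriv j (Torus.partialDeriv i f) x) (g x), mul_comm f₁ g₁, mul_comm f₀ g₂]
    exact h2 i j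
  · rw [e, mul_comm (Torus.partialDeriv k (Torus.partialDeriv j (Torus.partialDeriv i f)) x) (g x),
      mul_comm f₂ g₁, mul_comm f₁ g₂, mul_comm f₀ g₃]
    exact h3 i j k

/-- **Linearity of iterated partial derivatives on finite sums and differences of smooth functions**
(orders 2 and 3, applied forms; order 1 is `Torus.partialDeriv_finset_sum` / `partialDeriv_sub`).
[folklore] -/
theorem partialDeriv_iter_sum_sub :
    (∀ {ι : Type} (s : Finset ι) {F : ι → T3 → ℝ}, (∀ m ∈ s, Torus.IsSmooth (F m)) →
      ∀ (i j : Fin 3) (x : T3),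
        Torus.partialDeriv j (Torus.partialDeriv i (fun y => ∑ m ∈ s, F m y)) x =
          ∑ m ∈ s, Torus.partialDeriv j (Torus.partialDeriv i (F m)) x) ∧
    (∀ {ι : Type} (s : Finset ι) {F : ι → T3 → ℝ}, (∀ m ∈ s, Torus.IsSmooth (F m)) →
      ∀ (i j k : Fin 3) (x : T3),
        Torus.partialDeriv k (Torus.partialDeriv j (Torus.partialDeriv i (fun y => ∑ m ∈ s, F m y))) x =
          ∑ m ∈ s, Torus.partialDeriv k (Torus.partialDeriv j (Torus.partialDeriv i (F m))) x) ∧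
    (∀ {F G : T3 → ℝ}, Torus.IsSmooth F → Torus.IsSmooth G → ∀ (i j : Fin 3) (x : T3),
        Torus.partialDeriv j (Torus.partialDeriv i (fun y => F y - G y)) x =
          Torus.partialDeriv j (Torus.partialDeriv i F) x - Torus.partialDeriv j (Torus.partialDeriv i G) x) ∧
    (∀ {F G : T3 → ℝ}, Torus.IsSmooth F → Torus.IsSmooth G → ∀ (i j k : Fin 3) (x : T3),
        Torus.partialDeriv k (Torus.partialDeriv j (Torus.partialDeriv i (fun y => F y - G y))) x =
          Torus.partialDeriv k (Torus.partialDeriv j (Torus.partialDeriv i F)) x -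
            Torus.partialDeriv k (Torus.partialDeriv j (Torus.partialDeriv i G)) x) ∧
    (∀ {F : T3 → ℝ}, Torus.IsSmooth F → ∀ (c : ℝ) (i j k : Fin 3) (x : T3),
        Torus.partialDeriv k (Torus.partialDeriv j (Torus.partialDeriv i (fun y => c * F y))) x =
          c * Torus.partialDeriv k (Torus.partialDeriv j (Torus.partialDeriv i F)) x) := by
  refine ⟨fun s F hF i j x => ?_, fun s F hF i j k x => ?_, fun hF hG i j x => ?_,
    fun hF hG i j k x => ?_, fun hF c i j k x => (Torus.partialDeriv₃_const_mul hF c i j k x).2.2⟩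
  · rw [partialDeriv_fun_sum s hF i,
      partialDeriv_fun_sum s (F := fun m => Torus.partialDeriv i (F m)) (fun m hm => (hF m hm).partialDeriv i) j]
  · rw [partialDeriv_fun_sum s hF i,
      partialDeriv_fun_sum s (F := fun m => Torus.partialDeriv i (F m)) (fun m hm => (hF m hm).partialDeriv i) j,
      partialDeriv_fun_sum s (F := fun m => Torus.partialDeriv j (Torus.partialDeriv i (F m)))
        (fun m hm => ((hF m hm).partialDeriv i).partialDeriv j) k]
  · rw [partialDeriv_fun_sub hF hG i, partialDeriv_fun_sub (hF.partialDeriv i) (hG.partialDeriv i) j]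
  · rw [partialDeriv_fun_sub hF hG i, partialDeriv_fun_sub (hF.partialDeriv i) (hG.partialDeriv i) j,
      partialDeriv_fun_sub ((hF.partialDeriv i).partialDeriv j) ((hG.partialDeriv i).partialDeriv j) k]

end Summit.AtomisticToContinuum.HydrodynamicLimit.Theorems

end
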